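import Summits.QuantumFields.YangMills.Theorems.ForcedResponseSkewnessResponseLocalisationSmearedKernelPerSite
import HarnessLib

/-!
# Route `ForcedResponseSkewness`, crux `ResponseLocalisation` (stmt-QuantumFields-24869), line «smeared-femto»:
# the registered analysis stub `stub_smearedKernelOfFemto : FBLPinnedSigR → NearPairLawSSigR → SmearedKernelSigR`

Lead `ym-line-frs-p1` g4 (`--supports stmt-QuantumFields-24869`).  The torus-level smeared collar kernel — for a pinned unit,
`Σ_{x : a(β)d_T(x,z₁) < R} |Σ_z w((l a β)z) κ₃^T(x,y,z)| ≤ κ·a(β)⁴` for a far sharp site `y` (`a(β) d_T(y,z₁) ≥ r₁`) and weights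
supported within `a(β)`-distance `R` of `z₁` with Riemann mass `a(β)⁴Σ|w| ≤ 2` — follows from the frozen-boundary law `FBL`
and the SMEARED near-pair law `NearPairLawS` along the pinned unit, by Georgii's conditional independence of separated volumes
(one torus DLR step around `y`, one around `z₁`; the tree's two-observable collar bound `Femto.abs_integral_two_sub_mean_le`):

with `s = min(r₁,ℓ₁,ℓ₂)/16`, `M = ⌊s/a(β)⌋`, the radius-`M+1` cubes around `y` and `z₁` are femto, inject into the torus and are
torus-disjoint; for `x` in the near ball let `x' = z₁ + w_x` be its cyclic representative (`|w_x| ≤ M/8`); the support sites `z`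
satisfy `|z − z₁| ≤ M/8`.  Then `Σ_z w_z κ₃(x,y,z) = ⟨(dens y − m_y)(A₂ − ⟨A₂⟩)⟩` with the smeared near observable
`A₂ = (dens x' − m_{x'}) Σ_z w_z (dens z − m_z)` carried by the cube around `z₁`, whose kernel mean is
`Σ_z w_z [kerCov_η(dens x', dens z) + (γ_η dens x' − m_{x'})(γ_η dens z − m_z)]`: by the smeared near-pair law (all of the support
is within `a(β)`-distance `2R_f ≤ R` of `x'`, at depth `≥ 7M/8`) and FBL twice it is exterior-uniformly within
`ε₂(x) = 16(κ' + Σ_z |w_z| μ_β(z − x'))/M⁴ + S_w·1024C₁²/M⁸` of `Σ_z w_z n_β(z − x')`, while `γ_η dens y` is within `ε₁ = C₁'/M⁴` of `p β`.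
The collar bound gives `|Σ_z w_z κ₃(x,y,z)| ≤ 4ε₁ε₂(x)`; summing over the near ball (`Σ_x μ(z − x') ≤ κ'` by injectivity of the
representatives, `#ball ≤ (3R_f/a)⁴`, `a⁴ S_w ≤ 2`, `1/M ≤ 2a/s`) gives `≤ κ a(β)⁴` for `κ' = κ s⁸/(2²³C₁')` and
`R_f ≤ κ s¹²/(81·2²⁶ C₁'³)`.

No summit is proved by any of this (leaf R2a `BalabanLadder.NT`, conditional rung line; `FBL` and `NearPairLawS` along the pinned
unit are the line's physics stubs; the YM mass gap is NOT proved).  Refs: Georgii (2011) Thm. 4.17; Seiler LNP 159 Ch. 2.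
-/

set_option autoImplicit false

noncomputable section

namespace Summit.QuantumFields.YangMills.Cruxes.ResponseLocalisation.Smeared

open MeasureTheory Filter Topology
open Literature.MathematicalPhysics.QuantumFieldTheory Literature.MathematicalPhysics.QuantumLattice
open Literature.Probability.LatticeModels
open Summit.QuantumFields.YangMills.Cruxes.OSLegsFromFemtoAndGap.DlrCollarTransfer
open Summit.QuantumFields.YangMills.Cruxes.RunningCouplingCeiling.Pointwise (torusDist)
open Summit.QuantumFields.YangMills.Cruxes.ResponseLocalisation.Birth
open Summit.QuantumFields.YangMills.Cruxes.ResponseLocalisation.Femto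

/-- Bookkeeping of the near-ball summation (pure real arithmetic): with `ε₁ = C/M⁴`, `κ' = κ s⁸/(2²³C)`, `1/M ≤ 2t/s`,
`#ball·t⁴ ≤ 81 R_f⁴`, `R_f ≤ 1`, `R_f ≤ κ s¹²/(81·2²⁶C³)`, `t⁴ S_w ≤ 2`, the three terms add up to at most `κ t⁴`. [folklore] -/
theorem sum_bound_arith (κ s t C Sw Rf cardB M : ℝ) (hκ : 0 < κ) (hs : 0 < s) (ht : 0 < t) (hC : 0 < C) (hM : 0 < M)
    (hSw0 : 0 ≤ Sw) (hMinv : 1 / M ≤ 2 * t / s) (hc4 : cardB * t ^ 4 ≤ 81 * Rf ^ 4) (hcard0 : 0 ≤ cardB) (hRf0 : 0 < Rf)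
    (hRf1 : Rf ≤ 1) (hRfκ : Rf ≤ κ * s ^ 12 / (81 * 2 ^ 26 * C ^ 3)) (hSw4 : t ^ 4 * Sw ≤ 2) :
    cardB * (4 * (C / M ^ 4) / (M / 2) ^ 4 * (κ * s ^ 8 / (2 ^ 23 * C))) +
      4 * (C / M ^ 4) / (M / 2) ^ 4 * (Sw * (κ * s ^ 8 / (2 ^ 23 * C))) +
      cardB * (4 * (C / M ^ 4) * (Sw * (1024 * C ^ 2 / M ^ 8))) ≤ κ * t ^ 4 := by
  have hMinv0 : 0 ≤ 1 / M := by positivity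
  have hRf4 : Rf ^ 4 ≤ Rf := pow_le_of_le_one hRf0.le hRf1 (by norm_num)
  have hRf41 : Rf ^ 4 ≤ 1 := hRf4.trans hRf1
  have h8 : (1 / M) ^ 8 ≤ (2 * t / s) ^ 8 := pow_le_pow_left₀ hMinv0 hMinv 8
  have h12 : (1 / M) ^ 12 ≤ (2 * t / s) ^ 12 := pow_le_pow_left₀ hMinv0 hMinv 12
  have hT1 : cardB * (4 * (C / M ^ 4) / (M / 2) ^ 4 * (κ * s ^ 8 / (2 ^ 23 * C))) ≤ κ * t ^ 4 / 4 := by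
    have e1 : 4 * (C / M ^ 4) / (M / 2) ^ 4 * (κ * s ^ 8 / (2 ^ 23 * C)) = κ * s ^ 8 / 2 ^ 17 * (1 / M) ^ 8 := by
      field_simp; ring
    rw [e1]
    calc cardB * (κ * s ^ 8 / 2 ^ 17 * (1 / M) ^ 8)
        ≤ cardB * (κ * s ^ 8 / 2 ^ 17 * (2 * t / s) ^ 8) :=
          mul_le_mul_of_nonneg_left (mul_le_mul_of_nonneg_left h8 (by positivity)) hcard0
      _ = (cardB * t ^ 4) * (κ * t ^ 4 / 2 ^ 9) := by field_simp
      _ ≤ (81 * Rf ^ 4) * (κ * t ^ 4 / 2 ^ 9) := mul_le_mul_of_nonneg_right hc4 (by positivity)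
      _ ≤ 81 * (κ * t ^ 4 / 2 ^ 9) := by
          refine mul_le_mul_of_nonneg_right ?_ (by positivity)
          linarith only [hRf41]
      _ ≤ κ * t ^ 4 / 4 := by
          have : 0 < κ * t ^ 4 := by positivity
          nlinarith only [this]
  have hT2 : 4 * (C / M ^ 4) / (M / 2) ^ 4 * (Sw * (κ * s ^ 8 / (2 ^ 23 * C))) ≤ κ * t ^ 4 / 4 := by
    have e1 : 4 * (C / M ^ 4) / (M / 2) ^ 4 * (Sw * (κ * s ^ 8 / (2 ^ 23 * C))) = κ * s ^ 8 / 2 ^ 17 * Sw * (1 / M) ^ 8 := by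
      field_simp; ring
    rw [e1]
    calc κ * s ^ 8 / 2 ^ 17 * Sw * (1 / M) ^ 8 ≤ κ * s ^ 8 / 2 ^ 17 * Sw * (2 * t / s) ^ 8 :=
          mul_le_mul_of_nonneg_left h8 (by positivity)
      _ = (t ^ 4 * Sw) * (κ * t ^ 4 / 2 ^ 9) := by field_simp
      _ ≤ 2 * (κ * t ^ 4 / 2 ^ 9) := mul_le_mul_of_nonneg_right hSw4 (by positivity)
      _ ≤ κ * t ^ 4 / 4 := by
          have : 0 < κ * t ^ 4 := by positivity
          nlinarith only [this]
  have hT3 : cardB * (4 * (C / M ^ 4) * (Sw * (1024 * C ^ 2 / M ^ 8))) ≤ κ * t ^ 4 / 2 := by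
    have e1 : 4 * (C / M ^ 4) * (Sw * (1024 * C ^ 2 / M ^ 8)) = 4096 * C ^ 3 * Sw * (1 / M) ^ 12 := by
      field_simp; ring
    rw [e1]
    have hRfκ' : 81 * 2 ^ 26 * C ^ 3 * Rf ≤ κ * s ^ 12 := by
      have := (le_div_iff₀ (by positivity : (0 : ℝ) < 81 * 2 ^ 26 * C ^ 3)).1 hRfκ
      linarith only [this]
    calc cardB * (4096 * C ^ 3 * Sw * (1 / M) ^ 12)
        ≤ cardB * (4096 * C ^ 3 * Sw * (2 * t / s) ^ 12) :=
          mul_le_mul_of_nonneg_left (mul_le_mul_of_nonneg_left h12 (by positivity)) hcard0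
      _ = (cardB * t ^ 4) * (t ^ 4 * Sw) * (2 ^ 24 * C ^ 3 * t ^ 4 / s ^ 12) := by field_simp; ring
      _ ≤ (81 * Rf ^ 4) * (t ^ 4 * Sw) * (2 ^ 24 * C ^ 3 * t ^ 4 / s ^ 12) := by
          refine mul_le_mul_of_nonneg_right (mul_le_mul_of_nonneg_right hc4 (by positivity)) (by positivity)
      _ ≤ (81 * Rf ^ 4) * 2 * (2 ^ 24 * C ^ 3 * t ^ 4 / s ^ 12) := by
          refine mul_le_mul_of_nonneg_right (mul_le_mul_of_nonneg_left hSw4 (by positivity)) (by positivity)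
      _ ≤ (81 * Rf) * 2 * (2 ^ 24 * C ^ 3 * t ^ 4 / s ^ 12) := by
          refine mul_le_mul_of_nonneg_right (mul_le_mul_of_nonneg_right ?_ (by norm_num)) (by positivity)
          linarith only [hRf4]
      _ = (81 * 2 ^ 26 * C ^ 3 * Rf) * (t ^ 4 / (2 * s ^ 12)) := by field_simp
      _ ≤ (κ * s ^ 12) * (t ^ 4 / (2 * s ^ 12)) := mul_le_mul_of_nonneg_right hRfκ' (by positivity)
      _ = κ * t ^ 4 / 2 := by field_simp
  linarith only [hT1, hT2, hT3]

/-- **Registered stub `stub_smearedKernelOfFemto` of line «smeared-femto»**: the femto laws `FBL` and `NearPairLawS` along a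
pinned unit imply the torus-level smeared collar kernel `SmearedKernelSigR` (see the module docstring).  Georgii's conditional
independence of separated volumes, Thm. 4.17. [folklore] -/
theorem stub_smearedKernelOfFemto : SmearedKernelOfFemtoSigR := by
  intro hFBL hNP G _ _ _ _ hG
  letI : MeasurableSpace G := borel G
  haveI : BorelSpace G := ⟨rfl⟩
  intro r a hpos hlim hpin r₁ hr₁ κ hκ
  classical
  haveI : SecondCountableTopology G :=
    (r.continuous.isClosedEmbedding r.injective).isEmbedding.secondCountableTopology
  obtain ⟨CA, hCA⟩ := r.curvature.bounded
  have hCA' : ∀ (u : Fin 4 → ℤ) (U : LGConfig 4 G), |dens G r u U| ≤ CA := fun u U => hCA _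
  -- the two femto laws along the pinned unit
  obtain ⟨C₁, β₁, ℓ₁, p, hℓ₁, hC₁, hF⟩ := hFBL G hG r a hpos hlim hpin
  obtain ⟨ℓ₂, hℓ₂, hN⟩ := hNP G hG r a hpos hlim hpin
  -- scales and constants
  set s : ℝ := min r₁ (min ℓ₁ ℓ₂) / 16 with hs
  have hmin : 0 < min r₁ (min ℓ₁ ℓ₂) := lt_min hr₁ (lt_min hℓ₁ hℓ₂)
  have hs0 : 0 < s := by rw [hs]; positivity
  have hs_r₁ : 16 * s ≤ r₁ := by
    have := min_le_left r₁ (min ℓ₁ ℓ₂); rw [hs]; linarith only [this]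
  have hs_ℓ₁ : 16 * s ≤ ℓ₁ := by
    have := (min_le_right r₁ (min ℓ₁ ℓ₂)).trans (min_le_left _ _); rw [hs]; linarith only [this]
  have hs_ℓ₂ : 16 * s ≤ ℓ₂ := by
    have := (min_le_right r₁ (min ℓ₁ ℓ₂)).trans (min_le_right _ _); rw [hs]; linarith only [this]
  have hC₁'0 : (0 : ℝ) < C₁ + 1 := by linarith only [hC₁]
  set κ' : ℝ := κ * s ^ 8 / (2 ^ 23 * (C₁ + 1)) with hκ'
  have hκ'0 : 0 < κ' := by rw [hκ']; positivity
  obtain ⟨R, hR, β₂, n, μ, hμ0, hμsum, hlaw⟩ := hN κ' hκ'0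
  set Rf : ℝ := min (min (R / 2) (s / 16)) (min 1 (κ * s ^ 12 / (81 * 2 ^ 26 * (C₁ + 1) ^ 3))) with hRf
  have hRf0 : 0 < Rf := by rw [hRf]; positivity
  have hRfR : 2 * Rf ≤ R := by
    have h1 : Rf ≤ R / 2 := (min_le_left _ _).trans (min_le_left _ _)
    linarith only [h1]
  have hRfs : Rf ≤ s / 16 := (min_le_left _ _).trans (min_le_right _ _)
  have hRf1 : Rf ≤ 1 := (min_le_right _ _).trans (min_le_left _ _)
  have hRfκ : Rf ≤ κ * s ^ 12 / (81 * 2 ^ 26 * (C₁ + 1) ^ 3) := (min_le_right _ _).trans (min_le_right _ _)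
  refine ⟨Rf, hRf0, ?_⟩
  intro w Λ _hΛ
  obtain ⟨β₃, hβ₃⟩ := hlaw w Λ
  obtain ⟨β₄, hβ₄⟩ := Filter.eventually_atTop.1 (hlim.eventually (gt_mem_nhds hRf0))
  refine ⟨max (max β₁ β₂) (max β₃ β₄), 4 * s + 8, ?_⟩
  intro β hβ L hL l hl y _hy z₁ _hz₁ _hzΛ hsep hsupp hRiem
  have hβ1 : β₁ ≤ β := le_trans ((le_max_left _ _).trans (le_max_left _ _)) hβ
  have hβ2 : β₂ ≤ β := le_trans ((le_max_right _ _).trans (le_max_left _ _)) hβ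
  have hβ3 : β₃ ≤ β := le_trans ((le_max_left _ _).trans (le_max_right _ _)) hβ
  have hβ4 : β₄ ≤ β := le_trans ((le_max_right _ _).trans (le_max_right _ _)) hβ
  have ht0 : 0 < a β := hpos β
  have htR : a β < Rf := hβ₄ β hβ4
  have ht1 : a β ≤ 1 := by linarith only [htR, hRf1]
  have hts16 : a β ≤ s / 16 := by linarith only [htR, hRfs]
  have hts4 : a β ≤ s / 4 := by linarith only [hts16, hs0]
  -- the cube radius `M = ⌊s / a β⌋`
  obtain ⟨hM4, hMle, hMge⟩ := floor_facts ht0 hts4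
  set M : ℕ := ⌊s / a β⌋₊ with hM
  have hM1 : 1 ≤ M := by omega
  have hM4r : (4 : ℝ) ≤ M := by exact_mod_cast hM4
  have hMpos : (0 : ℝ) < M := by linarith only [hM4r]
  have hMt : (M : ℝ) * a β ≤ s := (le_div_iff₀ ht0).1 hMle
  have hM2t : s ≤ 2 * (M : ℝ) * a β := by
    have := (div_le_iff₀ (by positivity : (0 : ℝ) < 2 * a β)).1 hMge
    linarith only [this]
  -- torus side: injectivity radius
  haveI : NeZero (2 * L + 1) := ⟨by omega⟩
  have h4M : 4 * M + 8 ≤ L := by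
    have h1 : (4 * (M : ℝ) + 8) * a β ≤ (L : ℝ) * a β := by
      have : (4 * (M : ℝ) + 8) * a β ≤ 4 * s + 8 := by nlinarith only [hMt, ht1, ht0]
      linarith only [this, hL]
    have h2 : (4 * (M : ℝ) + 8) ≤ L := le_of_mul_le_mul_right h1 ht0
    exact_mod_cast h2
  -- femto cubes of side `2M+3`
  have hside : ((2 * M + 3 : ℕ) : ℝ) * a β ≤ 3 * s := by push_cast; nlinarith only [hMt, hts4, ht0]
  have hb₁ : ((2 * M + 3 : ℕ) : ℝ) * a β ≤ ℓ₁ := by linarith only [hside, hs_ℓ₁, hs0]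
  have hb₂ : ((2 * M + 3 : ℕ) : ℝ) * a β ≤ ℓ₂ := by linarith only [hside, hs_ℓ₂, hs0]
  -- separation of `y` and `z₁` on the torus
  have hdist : 2 * ((2 : ℝ) * M + 4) ≤ torusDist L y z₁ := by
    have h1 : r₁ ≤ a β * torusDist L y z₁ := hsep
    have h2 : 16 * ((M : ℝ) * a β) ≤ a β * torusDist L y z₁ := by linarith only [h1, hMt, hs_r₁]
    have h3 : 16 * (M : ℝ) ≤ torusDist L y z₁ := by
      have h4 : a β * (16 * (M : ℝ)) ≤ a β * torusDist L y z₁ := by linarith only [h2]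
      exact le_of_mul_le_mul_left h4 ht0
    linarith only [h3, hM4r]
  obtain ⟨hsep_yz, hsep_zy⟩ := exists_coord_sep L M y z₁ hdist
  -- a lattice vector of small physical length has small coordinates
  have hnormv : ∀ v : Fin 4 → ℤ, a β * ‖siteToE v‖ ≤ Rf → ‖siteToE v‖ ≤ (M : ℝ) / 8 := by
    intro v hv
    have h4 : a β * ‖siteToE v‖ ≤ a β * ((M : ℝ) / 8) := by
      have e : a β * ((M : ℝ) / 8) = 2 * (M : ℝ) * a β / 16 := by ring
      rw [e]; linarith only [hv, hRfs, hM2t]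
    exact le_of_mul_le_mul_left h4 ht0
  have hcoord : ∀ v : Fin 4 → ℤ, a β * ‖siteToE v‖ ≤ Rf → ∀ j, |v j| ≤ ((M / 8 : ℕ) : ℤ) := by
    intro v hv j
    have h1 : |((v j : ℤ) : ℝ)| ≤ ‖siteToE v‖ := abs_apply_le_norm v j
    have h3 : ‖siteToE v‖ ≤ (M : ℝ) / 8 := hnormv v hv
    have h5 : ((8 * |v j| : ℤ) : ℝ) ≤ ((M : ℤ) : ℝ) := by push_cast; linarith only [h1, h3]
    have h6 : (8 * |v j| : ℤ) ≤ (M : ℤ) := by exact_mod_cast h5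
    omega
  ----------------------------------------------------------------------------------------------
  -- the weights, their lattice support `S` and its mass
  ----------------------------------------------------------------------------------------------
  set wt : (Fin 4 → ℤ) → ℝ := fun z => w ((l * a β) • siteToE z) with hwt
  set S : Finset (Fin 4 → ℤ) := (box 4 L).filter (fun z => wt z ≠ 0) with hS
  have hS_mem : ∀ z ∈ S, a β * ‖siteToE (z - z₁)‖ ≤ Rf := fun z hz => (hsupp z (Finset.mem_filter.1 hz).2).2
  have hS_all : ∀ z : Fin 4 → ℤ, w ((l * a β) • siteToE z) ≠ 0 → z ∈ S := fun z hz =>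
    Finset.mem_filter.2 ⟨(hsupp z hz).1, hz⟩
  set Sw : ℝ := ∑ z ∈ S, |wt z| with hSw
  have hSw0 : 0 ≤ Sw := Finset.sum_nonneg fun _ _ => abs_nonneg _
  have hSw4 : a β ^ 4 * Sw ≤ 2 := by
    have h1 : Sw ≤ ∑ z ∈ box 4 L, |wt z| :=
      Finset.sum_le_sum_of_subset_of_nonneg (Finset.filter_subset _ _) fun _ _ _ => abs_nonneg _
    exact (mul_le_mul_of_nonneg_left h1 (by positivity)).trans hRiem
  have hSz : ∀ z ∈ S, ∀ j, |(z - z₁) j| ≤ ((M / 8 : ℕ) : ℤ) := fun z hz => hcoord (z - z₁) (hS_mem z hz)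
  -- the smeared near-pair law at `β`, spacing `l`, the cube around `z₁`, support `S`
  have hlawS : ∀ (η : LGConfig 4 G) (x : Fin 4 → ℤ),
      (∀ z ∈ S, a β * ‖siteToE (z - x)‖ ≤ R ∧ 2 * ‖siteToE (z - x)‖ + 2 ≤ (depth (fun k => z₁ k - (M + 1)) (2 * M + 3) x : ℝ)) →
      |∑ z ∈ S, wt z * (kerCov G r β (fun k => z₁ k - (M + 1)) (2 * M + 3) η (dens G r x) (dens G r z) - n β (z - x))| ≤
        (κ' + ∑ z ∈ S, |wt z| * μ β (z - x)) / (depth (fun k => z₁ k - (M + 1)) (2 * M + 3) x : ℝ) ^ 4 :=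
    fun η x hcond => hβ₃ β hβ2 hβ3 (fun k => z₁ k - (M + 1)) (2 * M + 3) hb₂ η x l hl S hS_all hcond
  ----------------------------------------------------------------------------------------------
  -- the per-site bound: for `x` in the near ball, `|Σ_z w_z κ₃(x,y,z)| ≤ 4 ε₁ ε₂(x)`
  ----------------------------------------------------------------------------------------------
  set ε₁ : ℝ := (C₁ + 1) / (M : ℝ) ^ 4 with hε₁
  set wr : (Fin 4 → ℤ) → (Fin 4 → ℤ) := fun x k => ((((x k - z₁ k : ℤ) : ZMod (2 * L + 1))).valMinAbs : ℤ) with hwr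
  have key : ∀ x ∈ (box 4 L).filter (fun x => a β * torusDist L x z₁ < Rf),
      |∑ z ∈ box 4 L, wt z * torusK3 G r β L x y z| ≤ 4 * ε₁ *
        ((κ' + ∑ z ∈ S, |wt z| * μ β ((z - z₁) - wr x)) / ((M : ℝ) / 2) ^ 4 + Sw * (1024 * (C₁ + 1) ^ 2 / (M : ℝ) ^ 8)) := by
    intro x hx
    rw [Finset.mem_filter] at hx
    obtain ⟨-, hxd⟩ := hx
    have htw : a β * ‖siteToE (wr x)‖ ≤ Rf := by rw [hwr, norm_wrep]; exact hxd.le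
    have hwx : ∀ j, |wr x j| ≤ ((M / 8 : ℕ) : ℤ) := hcoord (wr x) htw
    have hcong : ∀ k, ((x k : ℤ) : ZMod (2 * L + 1)) = (((z₁ + wr x) k : ℤ) : ZMod (2 * L + 1)) :=
      fun k => (intCast_add_wrep L z₁ x k).symm
    -- restrict the weight sum to the support and move to the representative
    have hsumS : ∑ z ∈ box 4 L, wt z * torusK3 G r β L x y z = ∑ z ∈ S, wt z * torusK3 G r β L (z₁ + wr x) y z := by
      rw [hS, Finset.sum_filter]
      refine Finset.sum_congr rfl fun z _ => ?_
      by_cases h : wt z = 0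
      · simp [h]
      · rw [if_pos h, torusK3_congr_left r β L hcong y z]
    rw [hsumS]
    exact perSite_bound r β (a β) ℓ₁ C₁ (p β) κ' R Rf L M y z₁ wt S (n β) (μ β) hCA' ht0 hC₁ hκ'0 (hF β hβ1) hM4 hb₁ h4M
      hsep_yz hsep_zy (hμ0 β) hlawS hS_mem hSz hnormv hRfR (wr x) hwx htw
  ----------------------------------------------------------------------------------------------
  -- summation over the near ball
  ----------------------------------------------------------------------------------------------
  rw [← Finset.sum_filter]
  set B : Finset (Fin 4 → ℤ) := (box 4 L).filter (fun x => a β * torusDist L x z₁ < Rf) with hB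
  have hstep : ∑ x ∈ B, |∑ z ∈ box 4 L, wt z * torusK3 G r β L x y z| ≤
      ∑ x ∈ B, (4 * ε₁ / ((M : ℝ) / 2) ^ 4 * κ' +
        4 * ε₁ / ((M : ℝ) / 2) ^ 4 * ∑ z ∈ S, |wt z| * μ β ((z - z₁) - wr x) +
        4 * ε₁ * (Sw * (1024 * (C₁ + 1) ^ 2 / (M : ℝ) ^ 8))) := by
    refine Finset.sum_le_sum fun x hx => (key x hx).trans (le_of_eq ?_)
    ring
  rw [Finset.sum_add_distrib, Finset.sum_add_distrib, Finset.sum_const, Finset.sum_const, nsmul_eq_mul, nsmul_eq_mul,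
    ← Finset.mul_sum] at hstep
  -- `Σ_x Σ_z |w_z| μ(z − z₁ − wr x) ≤ S_w κ'`
  have hinjB : Set.InjOn wr B := (hwr ▸ wrep_injOn L z₁).mono fun x hx => by
    simp only [hB, Finset.coe_filter, Set.mem_setOf_eq] at hx
    exact Finset.mem_coe.2 hx.1
  have hμz : ∀ z ∈ S, ∑ x ∈ B, μ β ((z - z₁) - wr x) ≤ κ' := by
    intro z hz
    have hinj' : Set.InjOn (fun x => (z - z₁) - wr x) B := fun x hx x' hx' h => hinjB hx hx' (sub_right_injective h)
    rw [← Finset.sum_image (g := fun x => (z - z₁) - wr x) (f := fun v => μ β v) fun x hx x' hx' h => hinj' hx hx' h]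
    refine hμsum β _ hβ2 fun v hv => ?_
    obtain ⟨x, hx, rfl⟩ := Finset.mem_image.1 hv
    rw [hB, Finset.mem_filter] at hx
    have e : siteToE ((z - z₁) - wr x) = siteToE (z - z₁) - siteToE (wr x) := by
      ext i; simp [siteToE_apply]
    have hn : ‖siteToE ((z - z₁) - wr x)‖ ≤ ‖siteToE (z - z₁)‖ + ‖siteToE (wr x)‖ := by rw [e]; exact norm_sub_le _ _
    have h1 : a β * ‖siteToE (z - z₁)‖ ≤ Rf := hS_mem z hz
    have h2 : a β * ‖siteToE (wr x)‖ ≤ Rf := by rw [hwr, norm_wrep]; exact hx.2.le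
    nlinarith only [hn, h1, h2, hRfR, ht0]
  have hmid : ∑ x ∈ B, ∑ z ∈ S, |wt z| * μ β ((z - z₁) - wr x) ≤ Sw * κ' := by
    rw [Finset.sum_comm, hSw, Finset.sum_mul]
    refine Finset.sum_le_sum fun z hz => ?_
    rw [← Finset.mul_sum]
    exact mul_le_mul_of_nonneg_left (hμz z hz) (abs_nonneg _)
  -- the count of the near ball
  have hcardB : (B.card : ℝ) ≤ (2 * (Rf / a β) + 1) ^ 4 := by
    have hB' : B = (box 4 L).filter (fun x => torusDist L x z₁ < Rf / a β) := by
      rw [hB]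
      refine Finset.filter_congr fun x _ => ?_
      rw [lt_div_iff₀ ht0, mul_comm]
    rw [hB']
    exact card_filter_torusDist_lt_le L z₁ (by positivity)
  have hc4 : (B.card : ℝ) * a β ^ 4 ≤ 81 * Rf ^ 4 := by
    calc (B.card : ℝ) * a β ^ 4 ≤ (2 * (Rf / a β) + 1) ^ 4 * a β ^ 4 :=
          mul_le_mul_of_nonneg_right hcardB (by positivity)
      _ = (2 * Rf + a β) ^ 4 := by field_simp
      _ ≤ (3 * Rf) ^ 4 := pow_le_pow_left₀ (by positivity) (by linarith only [htR]) 4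
      _ = 81 * Rf ^ 4 := by ring
  -- arithmetic
  have hMinv : 1 / (M : ℝ) ≤ 2 * a β / s := by
    rw [div_le_div_iff₀ hMpos hs0]; linarith only [hM2t]
  have harith := sum_bound_arith κ s (a β) (C₁ + 1) Sw Rf (B.card : ℝ) (M : ℝ) hκ hs0 ht0 hC₁'0 hMpos hSw0 hMinv hc4
    (Nat.cast_nonneg _) hRf0 hRf1 hRfκ hSw4
  have hmid' := mul_le_mul_of_nonneg_left hmid (by positivity : (0 : ℝ) ≤ 4 * ε₁ / ((M : ℝ) / 2) ^ 4)
  simp only [hε₁, hκ'] at hstep hmid' harith ⊢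
  linarith only [hstep, hmid', harith]

end Summit.QuantumFields.YangMills.Cruxes.ResponseLocalisation.Smeared

end
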